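import Mathlib
import HarnessLib
import Summits.NavierStokesRegularity.NavierStokesRegularity.Theorems.PoloidalWindowDoorLrcModEntireShearedKinematicsField
import Summits.NavierStokesRegularity.NavierStokesRegularity.Theorems.PoloidalWindowDoorLrcModEntireSheetCauchyDataPeriodic
import Summits.NavierStokesRegularity.NavierStokesRegularity.Theorems.PoloidalWindowDoorLrcModEntireSheetSystemMixed
import Summits.NavierStokesRegularity.NavierStokesRegularity.Theorems.PoloidalWindowDoorLrcModEntireShearedSurjective
import Summits.NavierStokesRegularity.NavierStokesRegularity.Theorems.PoloidalWindowDoorLrcModEntireWeightSourceTranslate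

/-!
# Route `PoloidalWindowDoor`, item `LrcModEntire` (stmt-NavierStokesRegularity-20428), cell (Q4-sonic, straight, μ < 0) `stub_Q4sonicLineNeg`, case I —
# THE PERIODIC END MODULO ITS SECOND-ORDER ROW: the difference-system template applied, then the horizontal-period endgame

Cell ns-regularity-ideate, stub-worker seat ns-poloidal-K2-p2 g17 under the LEAD of item 20428 (ns-poloidal-K2-p3 g17, 21:14Z «after H2, the periodic assembly
(template call + END) is yours»); `--supports stmt-NavierStokesRegularity-20428 --as helper`.  Assembly of the PERIODIC END of `…CaseISonicTimes.caseI_false_of_ends`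
(its second hypothesis, box currency) from: the LEAD's kinematic rows for field components `…ShearedKinematicsField.pd_dN_PF_eq` / `pd_dN_QF_eq` (P1) applied to the
DIFFERENCE FIELD `D(t,x) = U(t, x + L·e) − U(t, x)` (poloidal, divergence-free: `…WeightSourceTranslate.class_translate`/`poloidal_translate` + linearity), the
Cauchy data `ϑ = ∂_mϑ = P_D = Q_D = 0` on the web sheet (`…SheetCauchyDataPeriodic.cauchyData_periodic_of_package`), the LEAD's mixed-system template
`…SheetSystemMixed.eq_zero_of_mixedSystem_template`, and the endgame `…ShearedSurjective.false_of_difference_eq_zero_on_tube` (over K2-p2 g17's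
`…HorizontalPeriodAtTime`).  The ONE input left as a hypothesis is the SECOND-ORDER ROW (hR3) of the template for the difference unknowns with smooth coefficients
on the tube — the sheared form of the LEAD's `…VerticalDifferenceLaw.verticalDifference_law` (P2b, in the pipeline), exactly in the template's shape.

* `isDivFree_sub`, `curl_sub_two` — linearity of divergence / third curl component for differentiable fields;
* ★★ `periodicEnd_of_verticalRow` — box currency + the periodic literal on `(τ₁, τ₂)` + [hR3 with smooth `dz, α₁, …, α₈` on the tube over
  `O = {y | y.1+1 ∈ (τ₁,τ₂), |y.2.2| < δ′}`] ⊢ `False`.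

WHAT THIS IS NOT: not a claim about Navier–Stokes regularity; the periodic END of the v14 child of the research slot `stub_Q4sonicLineNeg` modulo its second-order row;
no registry stub is closed here; items 20428 / 19708 / 27893 OPEN (bears_on LADDER-NS N0).
-/

noncomputable section

set_option linter.dupNamespace false
set_option linter.style.longLine false

namespace Summit.NavierStokesRegularity.NavierStokesRegularity.Theorems.PoloidalWindowDoorLrcModEntireCaseIPeriodicEnd

open Set Function Filter Topology Metric
open scoped RealInnerProductSpace InnerProductSpace ContDiff
open Literature.Analysis Literature.Analysis.FluidPDE
open Summit.NavierStokesRegularity.NavierStokesRegularity.Theorems.LocalSineTubeDoorProfileAlignedWindowRigidityAncient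
open Summit.NavierStokesRegularity.NavierStokesRegularity.Theorems.PoloidalWindowDoorPoloidalWindowRigidityWindow
open Summit.NavierStokesRegularity.NavierStokesRegularity.Theorems.PoloidalWindowDoorLrcModEntireSheetSystemUniqueness
open Summit.NavierStokesRegularity.NavierStokesRegularity.Theorems.PoloidalWindowDoorLrcModEntireSheetSystemMixed
open Summit.NavierStokesRegularity.NavierStokesRegularity.Theorems.PoloidalWindowDoorLrcModEntireSheetFlattenTools
open Summit.NavierStokesRegularity.NavierStokesRegularity.Theorems.PoloidalWindowDoorLrcModEntireShearedCoordinates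
open Summit.NavierStokesRegularity.NavierStokesRegularity.Theorems.PoloidalWindowDoorLrcModEntireShearedKinematics
open Summit.NavierStokesRegularity.NavierStokesRegularity.Theorems.PoloidalWindowDoorLrcModEntireShearedKinematicsField
open Summit.NavierStokesRegularity.NavierStokesRegularity.Theorems.PoloidalWindowDoorLrcModEntireSheetCauchyDataPeriodic
open Summit.NavierStokesRegularity.NavierStokesRegularity.Theorems.PoloidalWindowDoorLrcModEntireShearedSurjective
open Summit.NavierStokesRegularity.NavierStokesRegularity.Theorems.PoloidalWindowDoorLrcModEntireWeightSourceTranslate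

/-- Divergence-free fields form a subspace: the difference of two differentiable divergence-free fields is divergence-free. -/
theorem isDivFree_sub {f g : E3 → E3} (hf : Differentiable ℝ f) (hg : Differentiable ℝ g)
    (hdf : VectorCalculus.IsDivFree f) (hdg : VectorCalculus.IsDivFree g) : VectorCalculus.IsDivFree (fun x => f x - g x) := by
  intro x
  have h : fderiv ℝ (fun x => f x - g x) x = fderiv ℝ f x - fderiv ℝ g x := fderiv_sub (hf x) (hg x)
  unfold VectorCalculus.divergence
  rw [h, ContinuousLinearMap.toLinearMap_sub, map_sub]
  have h1 := hdf x
  have h2 := hdg x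
  unfold VectorCalculus.divergence at h1 h2
  rw [h1, h2, sub_zero]

/-- The third component of the curl is linear: `curl (f − g) x 2 = curl f x 2 − curl g x 2` for `f, g` differentiable at `x`. -/
theorem curl_sub_two {f g : E3 → E3} {x : E3} (hf : DifferentiableAt ℝ f x) (hg : DifferentiableAt ℝ g x) :
    curl (fun y => f y - g y) x 2 = curl f x 2 - curl g x 2 := by
  have h : fderiv ℝ (fun y => f y - g y) x = fderiv ℝ f x - fderiv ℝ g x := fderiv_sub hf hg
  simp [curl, h]
  ring

variable {C : ℝ} {U : ℝ → E3 → E3} {R μ : ℝ → ℝ → ℝ} {σ r ρ δ' : ℝ} {e : E3} {n₀ : ℝ × ℝ × ℝ → ℝ} {κt : ℝ → ℝ → ℝ}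

/-- ★★ **THE PERIODIC END OF CASE I, MODULO ITS SECOND-ORDER ROW.**  Box currency (class `U`, `σ = ±1`, (TH) slab law with `C³` slope, horizontal unit `e`, the
package block on `δ′ ≤ ρ`, `δ′ < 1/2`, sonic + parallel + `μ < 0` on the box), a time interval `(τ₁, τ₂) ⊂ [−δ′, δ′]`, an `s`-period `L > 0` of `U(−1+τ)` along every
web of `Σ_τ` for `τ ∈ (τ₁,τ₂)`, and — the one analytic input left — the second-order row of the mixed-system template for the difference unknowns
`(ϑ, P_D, Q_D) = (D₂, ⟪e,D⟫, ⟪Je,D⟫)∘Φ`, `D(t,x) = U(t,x+L·e) − U(t,x)`, `Φ` the moving shear over `d(t,z) = n₀(t+1,0,z)`, with smooth coefficients on the tube over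
`O = {y | y.1+1 ∈ (τ₁,τ₂), |y.2.2| < δ′}` and `dz p = Dd(p.1.1,p.1.2.2)[(0,1)]`.  Then `False`. -/
theorem periodicEnd_of_verticalRow
    (hrate : FluidPDE.HasTypeITimeDecay C U) (hcont : ContinuousOn (uncurry U) (Iio (0 : ℝ) ×ˢ univ))
    (hmild : ∀ s t : ℝ, s < t → t < 0 → ∀ x, U t x = UnboundedOperators.heatExtension (U s) (t - s) x - FluidPDE.oseenDuhamel 1 s U U t x)
    (hdiv : ∀ t < 0, FluidPDE.VectorCalculus.IsDivFree (U t))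
    (hpol : ∀ s < 0, ∀ y, ⟪FluidPDE.curl (U s) y, EuclideanSpace.single 2 1⟫_ℝ = 0)
    (hUne : U (-1) 0 2 ≠ 0)
    (hslabU : ∀ t : ℝ, |t + 1| < ρ → ∀ x : E3, |x 2| < ρ → ∀ b : Fin 3, b ≠ 2 →
      fderiv ℝ (U t) x (EuclideanSpace.single 2 1) b = μ t (x 2) * fderiv ℝ (U t) x (EuclideanSpace.single b 1) 2)
    (hδ'ρ : δ' ≤ ρ) (hδ'h : δ' < 1 / 2) (he2 : e 2 = 0) (hunit : e 0 ^ 2 + e 1 ^ 2 = 1)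
    (hpack : ∀ q : ℝ × ℝ × ℝ, |q.1| < δ' → |q.2.2| < δ' →
        n₀ q ∈ Ioo (-r) r ∧
        σ * U (-1 + q.1) (frameCLM e (q.2.1, n₀ q, q.2.2)) 2 = R q.1 q.2.2 ∧
        (∀ n ∈ Icc (-r) r, n ≠ n₀ q → σ * U (-1 + q.1) (frameCLM e (q.2.1, n, q.2.2)) 2 < R q.1 q.2.2) ∧
        (∀ w : E3, w 2 = 0 → fderiv ℝ (fun y => U (-1 + q.1) y 2) (frameCLM e (q.2.1, n₀ q, q.2.2)) w = 0) ∧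
        (∀ m : ℕ∞, ContDiffAt ℝ m n₀ q) ∧
        0 < κt q.1 q.2.2 ∧
        fderiv ℝ (fderiv ℝ (fun y => σ * U (-1 + q.1) y 2)) (frameCLM e (q.2.1, n₀ q, q.2.2)) e e +
            fderiv ℝ (fderiv ℝ (fun y => σ * U (-1 + q.1) y 2)) (frameCLM e (q.2.1, n₀ q, q.2.2)) (Jvec e) (Jvec e) =
          -κt q.1 q.2.2 ∧
        κt q.1 q.2.2 * (fderiv ℝ n₀ q ((0 : ℝ), (0 : ℝ), (1 : ℝ))) ^ 2 =
          (deriv (deriv (R q.1)) q.2.2 - μ (-1 + q.1) q.2.2 * κt q.1 q.2.2) * (1 + (fderiv ℝ n₀ q ((0 : ℝ), (1 : ℝ), (0 : ℝ))) ^ 2))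
    (hparI : ∀ τ s z : ℝ, |τ| < δ' → |z| < δ' → n₀ (τ, s, z) = n₀ (τ, (0 : ℝ), z))
    {τ₁ τ₂ L : ℝ} (hτ₁ : -δ' ≤ τ₁) (hτ₁₂ : τ₁ < τ₂) (hτ₂ : τ₂ ≤ δ') (hL : 0 < L)
    (hper : ∀ τ ∈ Ioo τ₁ τ₂, ∀ s z : ℝ, |z| < δ' →
      U (-1 + τ) (frameCLM e (s + L, n₀ (τ, s + L, z), z)) = U (-1 + τ) (frameCLM e (s, n₀ (τ, s, z), z)))
    {α₁ α₂ α₃ α₄ α₅ α₆ α₇ α₈ : Y3 × ℝ → ℝ}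
    (hα₁ : ContDiffOn ℝ ∞ α₁ (tube {y : Y3 | y.1 + 1 ∈ Ioo τ₁ τ₂ ∧ |y.2.2| < δ'}))
    (hα₂ : ContDiffOn ℝ ∞ α₂ (tube {y : Y3 | y.1 + 1 ∈ Ioo τ₁ τ₂ ∧ |y.2.2| < δ'}))
    (hα₃ : ContDiffOn ℝ ∞ α₃ (tube {y : Y3 | y.1 + 1 ∈ Ioo τ₁ τ₂ ∧ |y.2.2| < δ'}))
    (hα₄ : ContDiffOn ℝ ∞ α₄ (tube {y : Y3 | y.1 + 1 ∈ Ioo τ₁ τ₂ ∧ |y.2.2| < δ'}))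
    (hα₅ : ContDiffOn ℝ ∞ α₅ (tube {y : Y3 | y.1 + 1 ∈ Ioo τ₁ τ₂ ∧ |y.2.2| < δ'}))
    (hα₆ : ContDiffOn ℝ ∞ α₆ (tube {y : Y3 | y.1 + 1 ∈ Ioo τ₁ τ₂ ∧ |y.2.2| < δ'}))
    (hα₇ : ContDiffOn ℝ ∞ α₇ (tube {y : Y3 | y.1 + 1 ∈ Ioo τ₁ τ₂ ∧ |y.2.2| < δ'}))
    (hα₈ : ContDiffOn ℝ ∞ α₈ (tube {y : Y3 | y.1 + 1 ∈ Ioo τ₁ τ₂ ∧ |y.2.2| < δ'}))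
    (hR3 : ∀ p ∈ tube {y : Y3 | y.1 + 1 ∈ Ioo τ₁ τ₂ ∧ |y.2.2| < δ'},
      pd dN (pd dN ((fun q : ℝ × E3 => (U q.1 (q.2 + L • e) - U q.1 q.2) 2) ∘ shearMap e (fun q : ℝ × ℝ => n₀ (q.1 + 1, (0 : ℝ), q.2)))) p =
        α₁ p * pd (tg eS) (pd (tg eS) ((fun q : ℝ × E3 => (U q.1 (q.2 + L • e) - U q.1 q.2) 2) ∘ shearMap e (fun q : ℝ × ℝ => n₀ (q.1 + 1, (0 : ℝ), q.2)))) p +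
        α₂ p * pd (tg eT) ((fun q : ℝ × E3 => (U q.1 (q.2 + L • e) - U q.1 q.2) 2) ∘ shearMap e (fun q : ℝ × ℝ => n₀ (q.1 + 1, (0 : ℝ), q.2))) p +
        α₃ p * pd (tg PoloidalWindowDoorLrcModEntireShearedCoordinates.eZ)
          ((fun q : ℝ × E3 => (U q.1 (q.2 + L • e) - U q.1 q.2) 2) ∘ shearMap e (fun q : ℝ × ℝ => n₀ (q.1 + 1, (0 : ℝ), q.2))) p +
        α₄ p * pd (tg eS) ((fun q : ℝ × E3 => (U q.1 (q.2 + L • e) - U q.1 q.2) 2) ∘ shearMap e (fun q : ℝ × ℝ => n₀ (q.1 + 1, (0 : ℝ), q.2))) p +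
        α₅ p * pd dN ((fun q : ℝ × E3 => (U q.1 (q.2 + L • e) - U q.1 q.2) 2) ∘ shearMap e (fun q : ℝ × ℝ => n₀ (q.1 + 1, (0 : ℝ), q.2))) p +
        α₆ p * ((fun q : ℝ × E3 => (U q.1 (q.2 + L • e) - U q.1 q.2) 2) ∘ shearMap e (fun q : ℝ × ℝ => n₀ (q.1 + 1, (0 : ℝ), q.2))) p +
        α₇ p * ((fun q : ℝ × E3 => ⟪e, U q.1 (q.2 + L • e) - U q.1 q.2⟫) ∘ shearMap e (fun q : ℝ × ℝ => n₀ (q.1 + 1, (0 : ℝ), q.2))) p +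
        α₈ p * ((fun q : ℝ × E3 => ⟪Jvec e, U q.1 (q.2 + L • e) - U q.1 q.2⟫) ∘ shearMap e (fun q : ℝ × ℝ => n₀ (q.1 + 1, (0 : ℝ), q.2))) p) :
    False := by
  have hJabs : ∀ τ ∈ Ioo τ₁ τ₂, |τ| < δ' := fun τ hτ => abs_lt.2 ⟨by linarith [hτ.1], by linarith [hτ.2]⟩
  have hδ' : 0 < δ' := by linarith
  set d : ℝ × ℝ → ℝ := fun q => n₀ (q.1 + 1, (0 : ℝ), q.2) with hd_def
  set O : Set Y3 := {y | y.1 + 1 ∈ Ioo τ₁ τ₂ ∧ |y.2.2| < δ'} with hO_def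
  set V : ℝ × E3 → E3 := fun q => U q.1 (q.2 + L • e) - U q.1 q.2 with hV_def
  have hO : IsOpen O := by
    have h1 : IsOpen {y : Y3 | y.1 + 1 ∈ Ioo τ₁ τ₂} := isOpen_Ioo.preimage (continuous_fst.add continuous_const)
    have h2 : IsOpen {y : Y3 | |y.2.2| < δ'} := isOpen_lt (continuous_abs.comp (continuous_snd.comp continuous_snd)) continuous_const
    exact h1.inter h2
  have hObox : ∀ y ∈ O, |y.1 + 1| < δ' ∧ |y.2.2| < δ' := fun y hy => ⟨hJabs _ hy.1, hy.2⟩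
  -- the parameter box of `d` and the time range
  set D : Set (ℝ × ℝ) := {q | |q.1 + 1| < δ' ∧ |q.2| < δ'} with hD_def
  have hD : IsOpen D := by
    refine IsOpen.and ?_ ?_
    · exact isOpen_lt (continuous_abs.comp (continuous_fst.add continuous_const)) continuous_const
    · exact isOpen_lt (continuous_abs.comp continuous_snd) continuous_const
  have hd : ContDiffOn ℝ ∞ d D := by
    intro q hq
    obtain ⟨-, -, -, -, hnC, -, -, -⟩ := hpack (q.1 + 1, (0 : ℝ), q.2) hq.1 hq.2
    have hline : ContDiff ℝ ∞ (fun q' : ℝ × ℝ => ((q'.1 + 1, (0 : ℝ), q'.2) : ℝ × ℝ × ℝ)) :=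
      (contDiff_fst.add contDiff_const).prodMk (contDiff_const.prodMk contDiff_snd)
    have h1 : ContDiffAt ℝ ∞ n₀ ((fun q' : ℝ × ℝ => ((q'.1 + 1, (0 : ℝ), q'.2) : ℝ × ℝ × ℝ)) q) := by simpa using hnC ⊤
    exact (h1.comp q hline.contDiffAt).contDiffWithinAt
  have hOD : ∀ y ∈ O, (y.1, y.2.2) ∈ D := fun y hy => hObox y hy
  set T : Set ℝ := Iio 0 with hT_def
  have hT : IsOpen T := isOpen_Iio
  have hOT : ∀ y ∈ O, y.1 ∈ T := fun y hy => by
    have h := (abs_lt.1 (hObox y hy).1).2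
    show y.1 < 0; linarith [hδ'h]
  -- the difference field: smooth, poloidal, divergence-free, analytic slices
  have hA := isTypeIAncientMild_of_class hrate hcont hmild hdiv
  have hW : ContDiffOn ℝ ∞ (uncurry U) (T ×ˢ (univ : Set E3)) := hA.contDiffOn
  obtain ⟨hrateL, hcontL, hmildL, hdivL⟩ := class_translate hrate hcont hmild hdiv (L • e)
  have hAL := isTypeIAncientMild_of_class hrateL hcontL hmildL hdivL
  have hWL : ContDiffOn ℝ ∞ (uncurry fun t x => U t (x + L • e)) (T ×ˢ (univ : Set E3)) := hAL.contDiffOn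
  have hV : ContDiffOn ℝ ∞ V (T ×ˢ (univ : Set E3)) := by
    have h := hWL.sub hW
    refine h.congr fun q _ => ?_
    simp [hV_def, uncurry]
  have hsliceU : ∀ t ∈ T, Differentiable ℝ (U t) := fun t ht => (hA.contDiff_slice ht).differentiable (by simp)
  have hsliceUL : ∀ t ∈ T, Differentiable ℝ (fun x : E3 => U t (x + L • e)) := fun t ht => (hAL.contDiff_slice ht).differentiable (by simp)
  have hpolL := poloidal_translate (v := U) hpol (L • e)
  have hcurl : ∀ t ∈ T, ∀ x : E3, FluidPDE.curl (fun y : E3 => V (t, y)) x 2 = 0 := by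
    intro t ht x
    have h1 := hpolL t ht x
    have h2 := hpol t ht x
    rw [EuclideanSpace.inner_single_right] at h1 h2
    simp only [one_mul, conj_trivial] at h1 h2
    have h := curl_sub_two (f := fun y : E3 => U t (y + L • e)) (g := U t) ((hsliceUL t ht) x) ((hsliceU t ht) x)
    show FluidPDE.curl (fun y : E3 => U t (y + L • e) - U t y) x 2 = 0
    rw [h]
    have h1' : FluidPDE.curl (fun y : E3 => U t (y + L • e)) x 2 = 0 := h1
    rw [h1', h2, sub_zero]
  have hdivV : ∀ t ∈ T, FluidPDE.VectorCalculus.IsDivFree (fun y : E3 => V (t, y)) := fun t ht =>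
    isDivFree_sub (hsliceUL t ht) (hsliceU t ht) (hdivL t ht) (hdiv t ht)
  have hVan : ∀ t ∈ T, AnalyticOnNhd ℝ (fun x : E3 => V (t, x)) univ := by
    intro t ht x _
    have h1 : AnalyticOnNhd ℝ (U t) univ := analyticOnNhd_slice hcont (bdd_of_hasTypeITimeDecay hrate) hmild ht
    have h2 : AnalyticOnNhd ℝ (fun x : E3 => U t (x + L • e)) univ := analyticOnNhd_slice hcontL (bdd_of_hasTypeITimeDecay hrateL) hmildL ht
    exact (h2 x (mem_univ _)).sub (h1 x (mem_univ _))
  -- smoothness of the three unknowns on the tube, analyticity of `ϑ` along normal lines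
  obtain ⟨hgs, hPs, hQs⟩ := contDiffOn_gF_PF_QF (e := e) hV
  have hg := contDiffOn_comp_shearMap (e := e) hT hgs hOT hD hd hOD
  have hP := contDiffOn_comp_shearMap (e := e) hT hPs hOT hD hd hOD
  have hQ := contDiffOn_comp_shearMap (e := e) hT hQs hOT hD hd hOD
  have hgan : ∀ y ∈ O, AnalyticOnNhd ℝ (fun m : ℝ => ((fun q : ℝ × E3 => V q 2) ∘ shearMap e d) (y, m)) univ := fun y hy =>
    analyticOnNhd_normalLine_comp_shearMap (fun t ht => (analyticOnNhd_slices_F (e := e) hVan ht).1) hOT hy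
  -- the kinematic rows
  have hR1 : ∀ p ∈ tube O, pd dN ((fun q : ℝ × E3 => ⟪e, V q⟫_ℝ) ∘ shearMap e d) p = pd (tg eS) ((fun q : ℝ × E3 => ⟪Jvec e, V q⟫_ℝ) ∘ shearMap e d) p :=
    fun p hp => pd_dN_PF_eq hT hV hcurl he2 hOT hD hd hOD hp
  have hR2 := fun p (hp : p ∈ tube O) => pd_dN_QF_eq (e := e) hT hV hdivV he2 hunit hOT hD hd hOD hp
  have hdz : ContDiffOn ℝ ∞ (fun p : Y3 × ℝ => fderiv ℝ d (p.1.1, p.1.2.2) ((0 : ℝ), (1 : ℝ))) (tube O) := by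
    have hd1 : ContDiffOn ℝ ∞ (fun q => fderiv ℝ d q ((0 : ℝ), (1 : ℝ))) D := (hd.fderiv_of_isOpen hD (by simp)).clm_apply contDiffOn_const
    have hproj : ContDiff ℝ ∞ (fun p : Y3 × ℝ => ((p.1.1, p.1.2.2) : ℝ × ℝ)) :=
      (contDiff_fst.comp contDiff_fst).prodMk ((contDiff_snd.comp contDiff_snd).comp contDiff_fst)
    exact hd1.comp hproj.contDiffOn fun p hp => hOD p.1 hp
  -- the Cauchy data
  have hdata := fun (y : Y3) (hy : y ∈ O) =>
    cauchyData_periodic_of_package (C := C) (σ := σ) (R := R) (μ := μ) (κt := κt) (L := L) hrate hcont hmild hdiv hδ'h hpack hparI hJabs hper hy.1 hy.2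
  have hg0 : ∀ y ∈ O, ((fun q : ℝ × E3 => V q 2) ∘ shearMap e d) (y, 0) = 0 := fun y hy => (hdata y hy).1
  have hg1 : ∀ y ∈ O, pd dN ((fun q : ℝ × E3 => V q 2) ∘ shearMap e d) (y, 0) = 0 := fun y hy => (hdata y hy).2.1
  have hP0 : ∀ y ∈ O, ((fun q : ℝ × E3 => ⟪e, V q⟫_ℝ) ∘ shearMap e d) (y, 0) = 0 := fun y hy => (hdata y hy).2.2.1
  have hQ0 : ∀ y ∈ O, ((fun q : ℝ × E3 => ⟪Jvec e, V q⟫_ℝ) ∘ shearMap e d) (y, 0) = 0 := fun y hy => (hdata y hy).2.2.2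
  -- the template
  have hzero : ∀ y ∈ O, ∀ m : ℝ, ((fun q : ℝ × E3 => V q 2) ∘ shearMap e d) (y, m) = 0 := fun y hy m =>
    eq_zero_of_mixedSystem_template hO hg hP hQ hgan eS eT PoloidalWindowDoorLrcModEntireShearedCoordinates.eZ
      hdz hα₁ hα₂ hα₃ hα₄ hα₅ hα₆ hα₇ hα₈ hR1 hR2 hR3 hg0 hg1 hP0 hQ0 hy m
  -- the endgame at the time `t₀ = −1 + (τ₁+τ₂)/2`
  set t₀ : ℝ := -1 + (τ₁ + τ₂) / 2 with ht₀_def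
  have hmid : (τ₁ + τ₂) / 2 ∈ Ioo τ₁ τ₂ := ⟨by linarith, by linarith⟩
  have ht₀ : t₀ < 0 := by
    have h := (abs_lt.1 (hJabs _ hmid)).2
    rw [ht₀_def]; linarith [hδ'h]
  have ht₀ρ : |t₀ + 1| < ρ := by
    rw [ht₀_def, show -1 + (τ₁ + τ₂) / 2 + 1 = (τ₁ + τ₂) / 2 by ring]
    exact lt_of_lt_of_le (hJabs _ hmid) hδ'ρ
  have hρ : 0 < ρ := lt_of_lt_of_le hδ' hδ'ρ
  have hOt₀ : ∀ s z : ℝ, |z| < δ' → ((t₀, s, z) : Y3) ∈ O := fun s z hz =>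
    ⟨by rw [ht₀_def, show -1 + (τ₁ + τ₂) / 2 + 1 = (τ₁ + τ₂) / 2 by ring]; exact hmid, hz⟩
  have he : e ≠ 0 := by
    intro h0; rw [h0] at hunit; simp at hunit
  have hτv2 : (L • e) 2 = 0 := by simp [he2]
  have hτv : L • e ≠ 0 := smul_ne_zero hL.ne' he
  refine false_of_difference_eq_zero_on_tube hrate hcont hmild hdiv hpol hρ hslabU he2 hunit (d := d) (O := O) ht₀ ht₀ρ hδ' hOt₀ hτv2 hτv
    (fun y hy m => ?_) hUne
  have h := hzero y hy m
  simp only [Function.comp_apply, hV_def] at h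
  simpa using h

end Summit.NavierStokesRegularity.NavierStokesRegularity.Theorems.PoloidalWindowDoorLrcModEntireCaseIPeriodicEnd

end
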